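import Literature.NumberTheory.LFunctions.MatomakiRadziwillTaoKeyEstimate
import Literature.NumberTheory.LFunctions.MatomakiRadziwillTaoPropA3Proofs
import Literature.NumberTheory.LFunctions.TaoLogChowlaProofs
import Literature.NumberTheory.LFunctions.TaoLogElliottProp24
import HarnessLib

/-!
# Hardy–Littlewood–Chowla on average (Lichtman–Teräväinen 2022): the Möbius input (Prop. 2.1, `f = μ`)

Topic `Literature/NumberTheory/Sieve`, companion of `HardyLittlewoodChowla.lean` (the named facts
`lichtmanTeravainen2022_hlc_avg(_liouville)` = J. D. Lichtman, J. Teräväinen, *On the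
Hardy–Littlewood–Chowla conjecture on average*, Forum Math. Sigma 10 (2022) e57,
doi:10.1017/fms.2022.54, arXiv:2111.08912 [LichtmanTeravainen2022], Theorem 1.2 (i)), of
`HardyLittlewoodChowlaFourier.lean` (Prop. 3.2, whose hypothesis `𝖧₂` this file supplies) and
`HardyLittlewoodChowlaSieve.lean` (Lemma 2.11, which consumes the description of `𝒮ᶜ` below).
Everything in this file is PROVED; it introduces no definition and no named fact.

Step (I) of the printed outline (§1.2, §2.1, held copy `paper:arxiv-2111.08912` pp. 4–6):
"cancellation in short exponential sums of `μ` on average", i.e. **Proposition 2.1** for `f = μ`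
(Remark 2.2), deduced in print from Matomäki–Radziwiłł–Tao [MRTChow] = Algebra Number Theory 9
(2015), Theorem 2.3, together with the Vinogradov–Korobov bound (1.4) for `M(μ; X, Q)`.  Both
inputs are PROVED in the tree and are merely specialised here:

* `moebius_nonpretentiousness_ge` — (1.4): `M(μ; X, Q) ≥ ¼ log log X − C` for
  `Q ≤ (log X)^{1/125}` (`MatomakiRadziwillTao2015_liouvilleDistLowerBound_holds` for `λ`,
  `MRT2015.nonpretentiousness_congr_primes` to pass to `μ`);
* `moebius_typ_window_sq_le` — MRT Theorem 2.3 (`MRT2015.keyEstimate_typ`, with Theorem A.2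
  discharged by `MatomakiRadziwillTao2015_theoremA2_of_propA3 MatomakiRadziwillTao2015_propA3_holds`)
  for `g = μ`, window length `L = 2H`, level `X₃ = X + 2H`, in the `L²`-over-windows form
  `∑_{k ≤ X+2H} |∑_{m ∈ (k−2H,k]} μ1_𝒮(m) e(mα)|² ≤ C (2H)² (X+2H)/V` (all `α`) which is hypothesis
  `hA₂` of `LichtmanTeravainen2022.holder_fourier_bound`; the regime is MRT's
  (`W = V⁵`, `P₁ = W^{200}`, `Q₁ = 2H/W³`, `V⁵ ≤ (log X)^{1/125}`, `V^{1015} ≤ 2H`, `2H V^{75} ≤ X`,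
  `log 2H ≤ V`) plus `15 log V ≤ ¼ log log X − C_μ`; §4 takes `V` a power of `log H`;
* `indicator_not_typical_le`, `sum_log_seqP_div_log_seqQ_le` — the complement of the typical set:
  `1_{𝒮ᶜ}(m) ≤ ∑_{j ≤ √(log X₀), Q_j ≤ e^{√(log X₀)}} 1[m has no prime factor in [P_j, Q_j]]` and
  `∑_j log P_j/log Q_j ≤ 2 log P₁/log Q₁` ((2.1) and the first two displays of §4).

## References

* J. D. Lichtman, J. Teräväinen, Forum Math. Sigma 10 (2022) e57, arXiv:2111.08912, §2.1
  (Proposition 2.1, Remark 2.2, (2.1)), Remark 1.7 ((1.4)), §4.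
  [cite: LichtmanTeravainen2022, Proposition 2.1, Remark 2.2 and Section 4]
* K. Matomäki, M. Radziwiłł, T. Tao, Algebra Number Theory 9 (2015) 2167–2196, Theorem 2.3 and
  (1.12). [cite: MatomakiRadziwillTao2015, Theorem 2.3 and (1.12)]
-/

noncomputable section

open Finset Real
open scoped FourierTransform Classical

namespace Literature.NumberTheory.Sieve

namespace LichtmanTeravainen2022

open Literature.NumberTheory.LFunctions
open Literature.NumberTheory.LFunctions.MRT2015

/-! ### (1.12) for the Möbius function -/

/-- **Non-pretentiousness of `μ` (Vinogradov–Korobov)**: there are `C, X₀` with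
`M(μ; X, Q) ≥ ¼ log log X − C` for all `X ≥ X₀` and `1 ≤ Q ≤ (log X)^{1/125}` — the tree's proved
(1.12) of Matomäki–Radziwiłł–Tao for `λ` (`MatomakiRadziwillTao2015_liouvilleDistLowerBound_holds`,
with `ε = 1/12`), transferred to `μ` (`μ = λ` on primes).  This is display (1.4) of
[LichtmanTeravainen2022] (Remark 1.7). [cite: LichtmanTeravainen2022, Remark 1.7, display (1.4)] -/
theorem moebius_nonpretentiousness_ge : ∃ C X₀ : ℝ, ∀ X : ℝ, X₀ ≤ X → ∀ Q : ℝ, 1 ≤ Q →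
    Q ≤ Real.log X ^ (1 / 125 : ℝ) →
    (1 / 4) * Real.log (Real.log X) - C ≤
      Sieve.nonpretentiousness (⇑(ArithmeticFunction.moebius : ArithmeticFunction ℂ)) X Q := by
  obtain ⟨C, X₀, h⟩ :=
    MatomakiRadziwillTao2015_liouvilleDistLowerBound_holds.pretentiousDistSq_ge (1 / 12) (by norm_num)
  refine ⟨C, max X₀ 0, fun X hX Q hQ1 hQ => ?_⟩
  have hX0 : 0 ≤ X := le_trans (le_max_right _ _) hX
  have hXX₀ : X₀ ≤ X := le_trans (le_max_left _ _) hX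
  rw [nonpretentiousness_congr_primes (g := ⇑(ArithmeticFunction.liouville : ArithmeticFunction ℂ))
    (g' := ⇑(ArithmeticFunction.moebius : ArithmeticFunction ℂ)) ?_ X Q]
  · refine Tao2016.le_nonpretentiousness hX0 hQ1 fun q χ t hq hqQ ht => ?_
    have := h X hXX₀ q χ t hq (hqQ.trans hQ) ht
    linarith
  · intro p hp
    rw [ArithmeticFunction.intCoe_apply, ArithmeticFunction.moebius_apply_prime hp,
      liouville_complex_apply_prime hp]
    push_cast
    ring

/-! ### Matomäki–Radziwiłł–Tao for `μ 1_𝒮` on the windows `(k − 2H, k]` -/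

/-- Elementary: `t^{1/125} ≤ √(t/2)` for `t ≥ 16`. [folklore] -/
theorem rpow_inv125_le_sqrt_half {t : ℝ} (ht : 16 ≤ t) :
    t ^ (1 / 125 : ℝ) ≤ Real.sqrt (t / 2) := by
  have ht1 : 1 ≤ t := by linarith
  have ht0 : 0 ≤ t := by linarith
  have h1 : t ^ (1 / 125 : ℝ) ≤ t ^ (1 / 4 : ℝ) :=
    Real.rpow_le_rpow_of_exponent_le ht1 (by norm_num)
  refine h1.trans ?_
  have h14 : 0 ≤ t ^ (1 / 4 : ℝ) := Real.rpow_nonneg ht0 _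
  rw [Real.le_sqrt h14 (by positivity), ← Real.rpow_natCast, ← Real.rpow_mul ht0]
  norm_num
  -- `t^{1/2} ≤ t/2` iff `2 ≤ t^{1/2}`
  have h4 : (4 : ℝ) ^ (1 / 2 : ℝ) ≤ t ^ (1 / 2 : ℝ) :=
    Real.rpow_le_rpow (by norm_num) (by linarith) (by norm_num)
  have h2 : (4 : ℝ) ^ (1 / 2 : ℝ) = 2 := by
    rw [show (4 : ℝ) = 2 ^ (2 : ℝ) by norm_num, ← Real.rpow_mul (by norm_num)]; norm_num
  rw [h2] at h4
  have hsq : t ^ (1 / 2 : ℝ) * t ^ (1 / 2 : ℝ) = t := by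
    rw [← Real.rpow_add' ht0 (by norm_num)]; norm_num
  nlinarith [Real.rpow_nonneg ht0 (1 / 2 : ℝ)]

set_option maxHeartbeats 800000 in
/-- **The `𝖧₂` input (Lichtman–Teräväinen, Proposition 2.1 for `f = μ`, from
Matomäki–Radziwiłł–Tao, Theorem 2.3).**  There are `C, C_μ, V₀, X₀` such that for all natural
`X, H` and real `V` with `X ≥ X₀`, `V ≥ V₀`, `H ≥ 1`, `V⁵ ≤ (log X)^{1/125}`, `V^{1015} ≤ 2H`,
`2H·V^{75} ≤ X`, `log(2H) ≤ V` and `15 log V ≤ ¼ log log X − C_μ`, and for every real `α`,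
`∑_{k=1}^{X+2H} |∑_{m ∈ (k−2H, k]} μ(m) 1_𝒮(m) e(mα)|² ≤ C (2H)² (X + 2H)/V`,
where `𝒮 = 𝒮_{P₁,Q₁,√X₃,X₃}` is the Matomäki–Radziwiłł–Tao typical set with `W = V⁵`,
`P₁ = W^{200}`, `Q₁ = 2H/W³`, `X₃ = X + 2H` (`MRT2015.typFun`, `MRT2015.typicalSet`).
Proof: `MRT2015.keyEstimate_typ` (the tree's Theorem 2.3, proved, Theorem A.2 being discharged by
`MatomakiRadziwillTao2015_theoremA2_of_propA3 MatomakiRadziwillTao2015_propA3_holds`) for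
`g = μ` on `[0, X₃]` with `L = 2H`, the non-pretentiousness hypothesis coming from
`moebius_nonpretentiousness_ge`; the `L¹` bound is turned into an `L²` bound with
`|∑_{window}| ≤ 2H`, and the `2H − 1` truncated windows `k < 2H` are bounded trivially.
(Printed: Proposition 2.1, `sup_α ∫₀^X |∑_{x ≤ n ≤ x+H} f(n)1_𝒮(n)e(nα)| dx ≪ (e^{−M/2000} + H^{−δ}) HX`;
here with the saving `1/V` of MRT's Theorem 2.3 kept explicit, which is all §4 uses.)
[cite: LichtmanTeravainen2022, Proposition 2.1 and Remark 2.2]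
[cite: MatomakiRadziwillTao2015, Theorem 2.3] -/
theorem moebius_typ_window_sq_le : ∃ C Cμ V₀ X₀ : ℝ, 0 < C ∧ ∀ (X H : ℕ) (V α : ℝ),
    X₀ ≤ (X : ℝ) → V₀ ≤ V → 1 ≤ H →
    V ^ 5 ≤ Real.log X ^ (1 / 125 : ℝ) → V ^ 1015 ≤ ((2 * H : ℕ) : ℝ) →
    ((2 * H : ℕ) : ℝ) * V ^ 75 ≤ X → Real.log ((2 * H : ℕ) : ℝ) ≤ V →
    15 * Real.log V ≤ (1 / 4) * Real.log (Real.log X) - Cμ →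
    ∑ k ∈ Icc 1 (X + 2 * H), ‖∑ m ∈ Ioc (k - 2 * H) k,
        typFun (⇑(ArithmeticFunction.moebius : ArithmeticFunction ℂ)) ((V ^ 5) ^ 200)
          (((2 * H : ℕ) : ℝ) / (V ^ 5) ^ 3) (Real.sqrt ((X + 2 * H : ℕ) : ℝ))
          ((X + 2 * H : ℕ) : ℝ) m * (𝐞 ((m : ℝ) * α) : ℂ)‖ ^ 2 ≤
      C * ((2 * H : ℕ) : ℝ) ^ 2 * ((X + 2 * H : ℕ) : ℝ) / V := by
  obtain ⟨C, V₀, Xs, hC, hkey⟩ :=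
    keyEstimate_typ (MatomakiRadziwillTao2015_theoremA2_of_propA3 MatomakiRadziwillTao2015_propA3_holds)
  obtain ⟨Cμ, X₀, hM⟩ := moebius_nonpretentiousness_ge
  refine ⟨C + 1, Cμ, max V₀ 1, max (max Xs X₀) (Real.exp 16), by positivity, ?_⟩
  intro X H V α hX hV hH hV5 hV1015 hLV hlogL hMV
  -- the Möbius function as a `1`-bounded multiplicative complex arithmetic function
  set μc : ArithmeticFunction ℂ := (ArithmeticFunction.moebius : ArithmeticFunction ℂ) with hμc
  have hμmult : μc.IsMultiplicative := ArithmeticFunction.isMultiplicative_moebius.intCast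
  have hμ1 : ∀ n, ‖μc n‖ ≤ 1 := by
    intro n
    rw [hμc, ArithmeticFunction.intCoe_apply, Complex.norm_intCast]
    exact_mod_cast ArithmeticFunction.abs_moebius_le_one
  -- parameters
  set L : ℕ := 2 * H with hL
  set X₃ : ℝ := ((X + 2 * H : ℕ) : ℝ) with hX₃
  have hXs : Xs ≤ X := le_trans (le_trans (le_max_left _ _) (le_max_left _ _)) hX
  have hX₀ : X₀ ≤ X := le_trans (le_trans (le_max_right _ _) (le_max_left _ _)) hX
  have hX16 : Real.exp 16 ≤ X := le_trans (le_max_right _ _) hX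
  have hXpos : 0 < (X : ℝ) := lt_of_lt_of_le (Real.exp_pos _) hX16
  have hXX₃ : (X : ℝ) ≤ X₃ := by
    rw [hX₃]; push_cast; linarith [(Nat.cast_nonneg H : (0:ℝ) ≤ H)]
  have hX₃pos : 0 < X₃ := lt_of_lt_of_le hXpos hXX₃
  have hV1 : 1 ≤ V := le_trans (le_max_right _ _) hV
  have hV₀ : V₀ ≤ V := le_trans (le_max_left _ _) hV
  have hlogX : 16 ≤ Real.log X := by
    rw [← Real.log_exp 16]; exact Real.log_le_log (Real.exp_pos _) hX16
  have hlogX₃ : Real.log X ≤ Real.log X₃ := Real.log_le_log hXpos hXX₃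
  have hlogX₃16 : 16 ≤ Real.log X₃ := hlogX.trans hlogX₃
  have hL1 : (1 : ℝ) ≤ (L : ℝ) := by rw [hL]; exact_mod_cast (show 1 ≤ 2 * H by omega)
  have hL0 : (0 : ℝ) < (L : ℝ) := by linarith
  -- the hypotheses of Theorem 2.3
  have hV5' : V ^ 5 ≤ Real.log X₃ ^ (1 / 125 : ℝ) :=
    hV5.trans (Real.rpow_le_rpow (by linarith) hlogX₃ (by norm_num))
  have hLX₃ : (L : ℝ) * V ^ 75 ≤ X₃ := hLV.trans hXX₃
  have hLexp : (L : ℝ) ≤ Real.exp (Real.sqrt (Real.log X₃ / 2)) := by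
    have h1 : Real.log L ≤ Real.log X₃ ^ (1 / 125 : ℝ) := by
      calc Real.log L ≤ V := hlogL
        _ ≤ V ^ 5 := le_self_pow₀ hV1 (by norm_num)
        _ ≤ Real.log X₃ ^ (1 / 125 : ℝ) := hV5'
    have h2 := rpow_inv125_le_sqrt_half hlogX₃16
    calc (L : ℝ) = Real.exp (Real.log L) := (Real.exp_log hL0).symm
      _ ≤ Real.exp (Real.sqrt (Real.log X₃ / 2)) := Real.exp_le_exp.mpr (h1.trans h2)
  have hW1 : 1 ≤ V ^ 5 := one_le_pow₀ hV1
  have hM' : 15 * Real.log V ≤ Sieve.nonpretentiousness (⇑μc) X₃ (V ^ 5) := by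
    have h1 := hM X₃ (hX₀.trans hXX₃) (V ^ 5) hW1 hV5'
    have h2 : Real.log (Real.log X) ≤ Real.log (Real.log X₃) :=
      Real.log_le_log (by linarith) hlogX₃
    rw [hμc] at *
    linarith
  have hk := hkey X₃ X₃ V L α μc hμmult hμ1 (hXs.trans hXX₃) le_rfl (by linarith) hV₀ hV5' hV1015
    hLX₃ hLexp hlogL hM'
  have hfloor : ⌊X₃⌋₊ = X + 2 * H := by rw [hX₃, Nat.floor_natCast]
  rw [hfloor] at hk
  -- abbreviation for the restricted Möbius function
  set u : ℕ → ℂ := typFun (⇑μc) ((V ^ 5) ^ 200) ((L : ℝ) / (V ^ 5) ^ 3) (Real.sqrt X₃) X₃ with hu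
  have hu1 : ∀ n, ‖u n‖ ≤ 1 := fun n => norm_typFun_le hμ1 _ _ _ _ n
  -- each window sum is bounded by the window length
  have hwin : ∀ (s : Finset ℕ) (φ : ℕ → ℝ), ‖∑ m ∈ s, u m * (𝐞 (φ m) : ℂ)‖ ≤ #s := by
    intro s φ
    calc ‖∑ m ∈ s, u m * (𝐞 (φ m) : ℂ)‖ ≤ ∑ m ∈ s, ‖u m * (𝐞 (φ m) : ℂ)‖ :=
          norm_sum_le _ _
      _ ≤ ∑ m ∈ s, (1 : ℝ) := Finset.sum_le_sum fun m _ => by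
          rw [norm_mul, Circle.norm_coe, mul_one]; exact hu1 m
      _ = #s := by rw [Finset.sum_const, nsmul_eq_mul, mul_one]
  have hwinL : ∀ k, ‖∑ m ∈ Ioc (k - L) k, u m * (𝐞 ((m : ℝ) * α) : ℂ)‖ ≤ L := by
    intro k
    refine (hwin _ _).trans ?_
    rw [Nat.card_Ioc]
    exact_mod_cast (show k - (k - L) ≤ L by omega)
  -- split the range of `k`
  have hsplit : Icc 1 (X + 2 * H) = Ico 1 L ∪ Ico L (X + L + 1) := by
    ext k; simp only [Finset.mem_Icc, Finset.mem_union, Finset.mem_Ico, hL]; omega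
  have hdisj : Disjoint (Ico 1 L) (Ico L (X + L + 1)) := by
    rw [Finset.disjoint_left]; intro k hk hk'
    rw [Finset.mem_Ico] at hk hk'; omega
  rw [hsplit, Finset.sum_union hdisj]
  have hV0 : 0 < V := by linarith
  -- the truncated windows
  have hsmall : ∑ k ∈ Ico 1 L, ‖∑ m ∈ Ioc (k - 2 * H) k, u m * (𝐞 ((m : ℝ) * α) : ℂ)‖ ^ 2 ≤
      (L : ℝ) ^ 2 * X₃ / V := by
    calc ∑ k ∈ Ico 1 L, ‖∑ m ∈ Ioc (k - 2 * H) k, u m * (𝐞 ((m : ℝ) * α) : ℂ)‖ ^ 2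
        ≤ ∑ k ∈ Ico 1 L, (L : ℝ) ^ 2 := Finset.sum_le_sum fun k _ =>
          pow_le_pow_left₀ (norm_nonneg _) (hwinL k) 2
      _ ≤ L * (L : ℝ) ^ 2 := by
          rw [Finset.sum_const, Nat.card_Ico, nsmul_eq_mul]
          gcongr
          exact_mod_cast Nat.sub_le L 1
      _ = (L : ℝ) ^ 2 * ((L : ℝ) * V) / V := by field_simp
      _ ≤ (L : ℝ) ^ 2 * X₃ / V := by
          have hLVle : (L : ℝ) * V ≤ X₃ := by
            calc (L : ℝ) * V ≤ (L : ℝ) * V ^ 75 :=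
                  mul_le_mul_of_nonneg_left (le_self_pow₀ hV1 (by norm_num)) hL0.le
              _ ≤ X₃ := hLX₃
          exact div_le_div_of_nonneg_right (mul_le_mul_of_nonneg_left hLVle (by positivity)) hV0.le
  -- the full windows: `L¹ → L²` and Theorem 2.3
  have hbig : ∑ k ∈ Ico L (X + L + 1), ‖∑ m ∈ Ioc (k - 2 * H) k, u m * (𝐞 ((m : ℝ) * α) : ℂ)‖ ^ 2 ≤
      (L : ℝ) * (C * L * X₃ / V) := by
    rw [Finset.sum_Ico_eq_sum_range]
    have hrange : X + L + 1 - L = X + 1 := by omega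
    rw [hrange]
    have hterm : ∀ x ∈ Finset.range (X + 1),
        ‖∑ m ∈ Ioc (L + x - 2 * H) (L + x), u m * (𝐞 ((m : ℝ) * α) : ℂ)‖ ^ 2 ≤
          (L : ℝ) * ‖∑ n ∈ Ioc x (x + L), u n * (𝐞 (α * n) : ℂ)‖ := by
      intro x _
      have hw : Ioc (L + x - 2 * H) (L + x) = Ioc x (x + L) := by
        rw [hL]; congr 1 <;> omega
      have he : ∀ m : ℕ, (𝐞 ((m : ℝ) * α) : ℂ) = (𝐞 (α * m) : ℂ) := fun m => by rw [mul_comm]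
      simp_rw [hw, he]
      rw [sq]
      refine mul_le_mul_of_nonneg_right ?_ (norm_nonneg _)
      refine (hwin (Ioc x (x + L)) (fun m => α * m)).trans ?_
      rw [Nat.card_Ioc]
      exact_mod_cast (show x + L - x ≤ L by omega)
    refine (Finset.sum_le_sum hterm).trans ?_
    rw [← Finset.mul_sum]
    refine mul_le_mul_of_nonneg_left ?_ hL0.le
    refine le_trans ?_ hk
    refine Finset.sum_le_sum_of_subset_of_nonneg (fun x hx => ?_) (fun _ _ _ => norm_nonneg _)
    rw [Finset.mem_range] at hx ⊢; omega
  calc _ ≤ (L : ℝ) ^ 2 * X₃ / V + (L : ℝ) * (C * L * X₃ / V) := add_le_add hsmall hbig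
    _ = (C + 1) * (L : ℝ) ^ 2 * X₃ / V := by field_simp; ring


/-! ### The exceptional set `[1, Y] ∖ 𝒮` -/

/-- **Outside `𝒮` some interval carries no prime factor.**  For `1 ≤ m ≤ Y` not in
`𝒮_{P₁,Q₁,X₀,Y}` there is `1 ≤ j ≤ √(log X₀)` with `Q_j ≤ exp(√(log X₀))` and no prime factor of
`m` in `[P_j, Q_j]` (`log Q₁ ≥ 1`); as an inequality of indicators,
`1_{𝒮ᶜ}(m) ≤ ∑_j 1[m has no prime factor in [P_j, Q_j]]` (the paper's
"`𝒮ᶜ ⊂ ⋃_{j ≤ J} 𝒮_jᶜ`", §4). [cite: LichtmanTeravainen2022, Section 4, display (4.1)] -/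
theorem indicator_not_typical_le {P₁ Q₁ X₀ Y : ℝ} (hQ0 : 0 < Q₁) (hQ : 1 ≤ Real.log Q₁) {m : ℕ}
    (hm : m ∈ Icc 1 ⌊Y⌋₊) :
    (if m ∈ typicalSet P₁ Q₁ X₀ Y then (0 : ℝ) else 1) ≤
      ∑ j ∈ (Icc 1 ⌊Real.sqrt (Real.log X₀)⌋₊).filter
          (fun j => seqQ Q₁ j ≤ Real.exp (Real.sqrt (Real.log X₀))),
        (if HasFactorIn m (seqP P₁ Q₁ j) (seqQ Q₁ j) then (0 : ℝ) else 1) := by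
  have hnonneg : 0 ≤ ∑ j ∈ (Icc 1 ⌊Real.sqrt (Real.log X₀)⌋₊).filter
      (fun j => seqQ Q₁ j ≤ Real.exp (Real.sqrt (Real.log X₀))),
        (if HasFactorIn m (seqP P₁ Q₁ j) (seqQ Q₁ j) then (0 : ℝ) else 1) :=
    Finset.sum_nonneg fun j _ => by split_ifs <;> norm_num
  split_ifs with hS
  · exact hnonneg
  · have hm' := Finset.mem_Icc.mp hm
    have hnot : ¬ IsTypical P₁ Q₁ X₀ m := fun h => hS (mem_typicalSet.mpr ⟨hm', h⟩)
    unfold IsTypical at hnot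
    push Not at hnot
    obtain ⟨j, hj1, hjQ, hjn⟩ := hnot
    have hjmem : j ∈ (Icc 1 ⌊Real.sqrt (Real.log X₀)⌋₊).filter
        (fun j => seqQ Q₁ j ≤ Real.exp (Real.sqrt (Real.log X₀))) := by
      rw [Finset.mem_filter, Finset.mem_Icc]
      exact ⟨⟨hj1, Nat.le_floor (index_le_sqrt_log hj1 hQ0 hQ hjQ)⟩, hjQ⟩
    refine le_trans ?_ (Finset.single_le_sum (f := fun j =>
      (if HasFactorIn m (seqP P₁ Q₁ j) (seqQ Q₁ j) then (0 : ℝ) else 1))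
      (fun j _ => by split_ifs <;> norm_num) hjmem)
    simp only [if_neg hjn, le_refl]

/-- **`∑_j log P_j / log Q_j ≤ 2 log P₁ / log Q₁`** over any set of indices `j ≥ 1`
(`log P_j/log Q_j = (log P₁/log Q₁)/j²` and `∑ 1/j² ≤ 2`); the paper's
"`∑_{j ≤ J} log P_j/log Q_j ≪ log P₁/log Q₁`" ((2.1) and §4).
[cite: LichtmanTeravainen2022, display (2.1) and Section 4] -/
theorem sum_log_seqP_div_log_seqQ_le {P₁ Q₁ : ℝ} (hP : 0 ≤ Real.log P₁) (hQ : 0 < Real.log Q₁)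
    (s : Finset ℕ) (hs : ∀ j ∈ s, 1 ≤ j) :
    ∑ j ∈ s, Real.log (seqP P₁ Q₁ j) / Real.log (seqQ Q₁ j) ≤
      2 * (Real.log P₁ / Real.log Q₁) := by
  have hρ : 0 ≤ Real.log P₁ / Real.log Q₁ := div_nonneg hP hQ.le
  have h1 : ∀ j ∈ s, Real.log (seqP P₁ Q₁ j) / Real.log (seqQ Q₁ j) =
      Real.log P₁ / Real.log Q₁ * ((j : ℝ) ^ 2)⁻¹ := by
    intro j hj
    rw [log_seqP_div_log_seqQ (hs j hj) hQ.ne', div_eq_mul_inv]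
  rw [Finset.sum_congr rfl h1, ← Finset.mul_sum, mul_comm]
  refine mul_le_mul_of_nonneg_right ?_ hρ
  have hsub : s ⊆ Finset.Ioo 0 (s.sup id + 1) := by
    intro j hj
    rw [Finset.mem_Ioo]
    exact ⟨hs j hj, Nat.lt_succ_of_le (Finset.le_sup (f := id) hj)⟩
  calc ∑ j ∈ s, ((j : ℝ) ^ 2)⁻¹ ≤ ∑ j ∈ Finset.Ioo 0 (s.sup id + 1), ((j : ℝ) ^ 2)⁻¹ :=
        Finset.sum_le_sum_of_subset_of_nonneg hsub fun j _ _ => by positivity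
    _ ≤ 2 / ((0 : ℕ) + 1) := sum_Ioo_inv_sq_le 0 _
    _ = 2 := by norm_num

end LichtmanTeravainen2022

end Literature.NumberTheory.Sieve
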